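import Literature.NumberTheory.EllipticCurves.PastenValuationProductEpsilonProofs
import Literature.NumberTheory.EllipticCurves.SerreFreyValuationProductProofs
import Literature.NumberTheory.Sieve.ChenTheoremIHolds
import HarnessLib

/-!
# No uniform bound on `∏_{p ∥ N} v_p(Δ_min)` in the few-prime class — via Chen's theorem (proofs)

Topic `NumberTheory/EllipticCurves`; namespace `Literature.NumberTheory.EllipticCurves`. A proofs
file (theorems only), sequel of `PastenValuationProductEpsilonProofs` (Mersenne–Frey family; there
the few-prime `ε`-drop was refuted only conditionally on `ω(2ⁿ - 1) ≤ 3` infinitely often) and of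
`SerreFreyValuationProductProofs` (valuation product of a Serre-normalised Frey curve), using the
tree's PROVED Chen theorem in Goldbach form `Literature.NumberTheory.Sieve.chen_goldbach_holds`
(every large even number is `ℓ + m`, `ℓ` prime, `Ω(m) ≤ 2`; kernel-closed, standard axioms).

* `freyCurve_two_pow_spec` — for `a ≡ -1 (mod 4)`, `n ≥ 5`, `a + 2ⁿ ≠ 0`, the Frey curve
  `freyCurve a (2ⁿ)` (`y² = x(x - a)(x + 2ⁿ)`) is semistable, has at most `ω(|a|) + ω(|a + 2ⁿ|)` odd
  multiplicative primes, and `T := ∏_{p ∥ N} v_p(Δ_min) ≥ 2n - 8` (`v₂(Δ_min) = 2n - 8`).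
* `fewPrimeValuationProduct_false_without_eps` — UNCONDITIONALLY there is no `C` with `T(E) ≤ C` for
  every `E/ℚ` semistable away from `2` with `≤ 3` odd multiplicative primes: Chen splits `2ⁿ = ℓ + m`;
  `ℓ = 2` gives the Mersenne–Frey curve of `n - 1` (`2ⁿ⁻¹ - 1 ∣ m` has `≤ 2` prime factors),
  `ℓ ≡ 1 (4)` gives `freyCurve (-ℓ) (2ⁿ)`, `ℓ ≡ 3 (4)` gives `freyCurve (-m) (2ⁿ)`; in each case
  `≤ 3` odd multiplicative primes and `T ≥ 2n - 10`. This is the `ε = 0` case of the crux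
  `FewPrimeValuationProduct` of route ABC/RibetTakahashiSplit (stmt-ABC-1563): its `ε` is
  load-bearing (cdisprove seat refuter-cdisprove-stmt-ABC-1563-0, 2026-08-15). The `ε > 0` cases are
  consequences of Szpiro's conjecture (`ValuationProductOfSzpiroProofs`).

## References

* [ChenSciSinica1973] J.-R. Chen, *On the representation of a larger even integer as the sum of a
  prime and the product of at most two primes*, Sci. Sinica 16 (1973), Theorem I.
* [BombieriGubler2006] E. Bombieri, W. Gubler, *Heights in Diophantine Geometry*, Ex. 12.5.10.
* [PastenShimura2024] H. Pasten, *Shimura curves and the abc conjecture*, J. Number Theory 254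
  (2024), §16.
-/

noncomputable section

namespace Literature.NumberTheory.EllipticCurves

open Literature.NumberTheory.DiophantineGeometry UniqueFactorizationMonoid WeierstrassCurve

section TwoPow

/-- An integer `≡ -1 (mod 4)` is coprime to every power of `2`. [folklore] -/
private theorem isCoprime_two_pow_of_mod {a : ℤ} (ha : a ≡ -1 [ZMOD 4]) (n : ℕ) :
    IsCoprime a (2 ^ n) := by
  have h4 : (4 : ℤ) ∣ -1 - a := Int.ModEq.dvd ha
  obtain ⟨k, hk⟩ := h4
  have : IsCoprime a 2 := ⟨-1, -(2 * k), by linarith⟩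
  exact this.pow_right

/-- `ω(n) ≤ Ω(n)`: distinct prime factors versus prime factors with multiplicity. [folklore] -/
private theorem card_primeFactors_le_cardFactors (m : ℕ) :
    m.primeFactors.card ≤ ArithmeticFunction.cardFactors m := by
  rw [← Nat.toFinset_factors, ArithmeticFunction.cardFactors_apply]
  exact List.toFinset_card_le _

/-- **Frey curve of `a + 2ⁿ`** (`a ≡ -1 (mod 4)`, `n ≥ 5`, `a + 2ⁿ ≠ 0`): it is in the class
"semistable away from `2`" with at most `ω(|a|) + ω(|a + 2ⁿ|)` odd multiplicative primes, and
`T ≥ 2n - 8` (the factor at the multiplicative prime `2`, where `v₂(Δ_min) = 2n - 8`). [folklore] -/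
theorem freyCurve_two_pow_spec {a : ℤ} {n : ℕ} (ha : a ≡ -1 [ZMOD 4]) (hn : 5 ≤ n)
    (hc : a + 2 ^ n ≠ 0) :
    (freyCurve a (2 ^ n)).IsElliptic ∧
    (∀ p : ℕ, p.Prime → p ≠ 2 → ¬ p ^ 2 ∣ (freyCurve a (2 ^ n)).conductorNorm ℤ) ∧
    (((freyCurve a (2 ^ n)).conductorNorm ℤ).primeFactors.filter
        (fun p => p ≠ 2 ∧ ¬ p ^ 2 ∣ (freyCurve a (2 ^ n)).conductorNorm ℤ)).card ≤
      a.natAbs.primeFactors.card + (a + 2 ^ n).natAbs.primeFactors.card ∧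
    2 * n - 8 ≤ multiplicativeValuationProduct (freyCurve a (2 ^ n)) := by
  have ha0 : a ≠ 0 := by
    rintro rfl
    exact absurd (Int.ModEq.dvd ha) (by decide)
  have hodd : ¬ (2 : ℤ) ∣ a := by
    intro h2
    have h4 : (4 : ℤ) ∣ -1 - a := Int.ModEq.dvd ha
    omega
  have hab : IsCoprime a (2 ^ n) := isCoprime_two_pow_of_mod ha n
  have h0 : a * 2 ^ n * (a + 2 ^ n) ≠ 0 := mul_ne_zero (mul_ne_zero ha0 (by positivity)) hc
  have hb : (32 : ℤ) ∣ 2 ^ n := by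
    rw [show (32 : ℤ) = 2 ^ 5 by norm_num]; exact pow_dvd_pow 2 hn
  set M := (a * 2 ^ n * (a + 2 ^ n)).natAbs with hM
  have hM0 : M ≠ 0 := Int.natAbs_ne_zero.mpr h0
  have hMeq : M = a.natAbs * 2 ^ n * (a + 2 ^ n).natAbs := by
    rw [hM, Int.natAbs_mul, Int.natAbs_mul, Int.natAbs_pow]; rfl
  have hodd' : ¬ 2 ∣ a.natAbs := fun h => hodd (by exact_mod_cast Int.natCast_dvd.mpr h)
  have hcodd : ¬ (2 : ℤ) ∣ a + 2 ^ n := by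
    intro h
    exact hodd ((Int.dvd_add_left (dvd_pow_self 2 (by omega))).mp h)
  have hcodd' : ¬ 2 ∣ (a + 2 ^ n).natAbs := fun h =>
    hcodd (by exact_mod_cast Int.natCast_dvd.mpr h)
  -- v₂(M) = n
  have hM2 : M.factorization 2 = n := by
    rw [hMeq, Nat.factorization_mul (mul_ne_zero (Int.natAbs_ne_zero.mpr ha0) (by positivity))
      (Int.natAbs_ne_zero.mpr hc), Nat.factorization_mul (Int.natAbs_ne_zero.mpr ha0) (by positivity)]
    simp [Nat.factorization_eq_zero_of_not_dvd hodd', Nat.factorization_eq_zero_of_not_dvd hcodd',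
      Nat.prime_two.factorization_self]
  have h2M : 2 ∈ M.primeFactors :=
    Nat.mem_primeFactors.mpr ⟨Nat.prime_two, by
      rw [hMeq]; exact dvd_mul_of_dvd_left (dvd_mul_of_dvd_right (dvd_pow_self 2 (by omega)) _) _,
      hM0⟩
  refine ⟨isElliptic_freyCurve h0, fun p hp _ => freyCurve_serre_semistable hab h0 ha hb p hp, ?_, ?_⟩
  · -- odd multiplicative primes ⊆ primeFactors |a| ∪ primeFactors |a + 2ⁿ|
    rw [oddMultiplicativePrimes_freyCurve_serre hab h0 ha hb]
    refine le_trans (Finset.card_le_card ?_) (Finset.card_union_le _ _)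
    intro p hp
    rw [Finset.mem_erase] at hp
    obtain ⟨hp2, hp⟩ := hp
    have hpp := Nat.prime_of_mem_primeFactors hp
    have hdvd := Nat.dvd_of_mem_primeFactors hp
    rw [← hM, hMeq] at hdvd
    rw [Finset.mem_union, Nat.mem_primeFactors, Nat.mem_primeFactors]
    rcases (Nat.Prime.dvd_mul hpp).mp hdvd with h | h
    · rcases (Nat.Prime.dvd_mul hpp).mp h with h | h
      · exact Or.inl ⟨hpp, h, Int.natAbs_ne_zero.mpr ha0⟩
      · exact absurd ((Nat.prime_dvd_prime_iff_eq hpp Nat.prime_two).mp (hpp.dvd_of_dvd_pow h)) hp2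
    · exact Or.inr ⟨hpp, h, Int.natAbs_ne_zero.mpr hc⟩
  · -- T ≥ the factor at p = 2
    rw [multiplicativeValuationProduct_freyCurve_serre hab h0 ha hb, ← hM,
      ← Finset.mul_prod_erase _ _ h2M, if_pos rfl, hM2]
    refine Nat.le_mul_of_pos_right _ (Finset.prod_pos fun p hp => ?_)
    rw [Finset.mem_erase] at hp
    rw [if_neg hp.1]
    have := (Nat.prime_of_mem_primeFactors hp.2).factorization_pos_of_dvd hM0
      (Nat.dvd_of_mem_primeFactors hp.2)
    omega

/-- **No uniform bound on the few-prime class** (the `ε` of the crux `FewPrimeValuationProduct`,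
route ABC/RibetTakahashiSplit, stmt-ABC-1563, cannot be dropped — UNCONDITIONALLY): there is no `C`
with `∏_{p ∥ N} v_p(Δ_min) ≤ C` for all `E/ℚ` semistable away from `2` with `≤ 3` odd
multiplicative primes. For large `n`, Chen (`chen_goldbach_holds`): `2ⁿ = ℓ + m`, `ℓ` prime,
`Ω(m) ≤ 2`. If `ℓ = 2` then `2ⁿ⁻¹ - 1 ∣ m` has `≤ 2` prime factors and the Mersenne–Frey curve of
`n - 1` has `T ≥ 2n - 10`; if `ℓ` is odd, the Frey curve `freyCurve a (2ⁿ)` with `a = -ℓ`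
(`ℓ ≡ 1 (4)`) or `a = -m` (`ℓ ≡ 3 (4)`, so `m ≡ 1 (4)`) has `≤ 1 + 2` odd multiplicative primes and
`T ≥ 2n - 8`. [cite: ChenSciSinica1973, Theorem I (Goldbach form, via the tree's chen_goldbach_holds)] -/
theorem fewPrimeValuationProduct_false_without_eps :
    ¬ ∃ C : ℝ, ∀ (W : WeierstrassCurve ℚ) [W.IsElliptic],
      (∀ p : ℕ, p.Prime → p ≠ 2 → ¬ p ^ 2 ∣ W.conductorNorm ℤ) →
      ((W.conductorNorm ℤ).primeFactors.filter
          (fun p => p ≠ 2 ∧ ¬ p ^ 2 ∣ W.conductorNorm ℤ)).card ≤ 3 →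
      (multiplicativeValuationProduct W : ℝ) ≤ C := by
  rintro ⟨C, hC⟩
  obtain ⟨N₀, hN₀⟩ := Literature.NumberTheory.Sieve.chen_goldbach_holds
  set n := N₀ + ⌈C⌉₊ + 6 with hn
  have hnN : N₀ ≤ 2 ^ n := le_trans (by omega) (Nat.lt_two_pow_self).le
  have heven : Even (2 ^ n) := (Nat.even_pow' (by omega)).mpr even_two
  obtain ⟨ℓ, m, hℓ, ⟨hm0, hΩ⟩, hsum⟩ := hN₀ (2 ^ n) hnN heven
  have hωm : m.primeFactors.card ≤ 2 := (card_primeFactors_le_cardFactors m).trans hΩ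
  have hC' : C < (2 * n - 10 : ℕ) := by
    have h1 : C ≤ ⌈C⌉₊ := Nat.le_ceil C
    have h2 : (⌈C⌉₊ : ℝ) < (2 * n - 10 : ℕ) := by exact_mod_cast (by omega : ⌈C⌉₊ < 2 * n - 10)
    linarith
  -- a member of the few-prime class with `T ≥ 2n - 10` contradicts `hC`
  suffices h : ∃ (W : WeierstrassCurve ℚ), W.IsElliptic ∧
      (∀ p : ℕ, p.Prime → p ≠ 2 → ¬ p ^ 2 ∣ W.conductorNorm ℤ) ∧
      ((W.conductorNorm ℤ).primeFactors.filter
          (fun p => p ≠ 2 ∧ ¬ p ^ 2 ∣ W.conductorNorm ℤ)).card ≤ 3 ∧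
      2 * n - 10 ≤ multiplicativeValuationProduct W by
    obtain ⟨W, hE, h₁, hcard, hT⟩ := h
    haveI := hE
    have h := hC W h₁ hcard
    have hT' : ((2 * n - 10 : ℕ) : ℝ) ≤ multiplicativeValuationProduct W := by exact_mod_cast hT
    linarith
  by_cases hℓ2 : ℓ = 2
  · -- `m = 2ⁿ - 2 = 2 (2ⁿ⁻¹ - 1)`: the Mersenne–Frey curve of `n - 1`
    subst hℓ2
    have hdvd : mersenne (n - 1) ∣ m := by
      refine ⟨2, ?_⟩
      have h2n : 2 ^ n = 2 * 2 ^ (n - 1) := by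
        rw [← pow_succ', Nat.sub_add_cancel (by omega : 1 ≤ n)]
      simp only [mersenne]
      have : 1 ≤ 2 ^ (n - 1) := Nat.one_le_two_pow
      omega
    have hω : (mersenne (n - 1)).primeFactors.card ≤ 3 :=
      (Finset.card_le_card (Nat.primeFactors_mono hdvd hm0)).trans (hωm.trans (by norm_num))
    refine ⟨freyCurve (-1) (2 ^ (n - 1)), isElliptic_freyCurve_mersenne (by omega),
      freyCurve_mersenne_hyp₁ (by omega),
      by rw [oddMultiplicativePrimes_freyCurve_mersenne (by omega)]; exact hω, ?_⟩
    have := le_multiplicativeValuationProduct_freyCurve_mersenne (n := n - 1) (by omega)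
    omega
  · -- `ℓ` odd
    have hℓodd : ℓ % 2 = 1 := by
      rcases Nat.even_or_odd ℓ with h | h
      · exact absurd (hℓ.even_iff.mp h) hℓ2
      · exact Nat.odd_iff.mp h
    have h4 : 4 ∣ 2 ^ n := (pow_dvd_pow 2 (by omega : 2 ≤ n))
    have hωℓ : ℓ.primeFactors.card = 1 := by rw [hℓ.primeFactors, Finset.card_singleton]
    rcases Nat.odd_mod_four_iff.mp hℓodd with h1 | h3
    · -- `ℓ ≡ 1 (4)`: `a = -ℓ`, `a + 2ⁿ = m`
      have ha : (-(ℓ : ℤ)) ≡ -1 [ZMOD 4] := by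
        have : (ℓ : ℤ) % 4 = 1 := by exact_mod_cast h1
        exact Int.ModEq.neg this
      have hc : -(ℓ : ℤ) + 2 ^ n = m := by
        have := congrArg (fun k : ℕ => (k : ℤ)) hsum; push_cast at this; linarith
      have hc0 : -(ℓ : ℤ) + 2 ^ n ≠ 0 := by rw [hc]; exact_mod_cast hm0
      obtain ⟨hE, h₁, hcard, hT⟩ := freyCurve_two_pow_spec (n := n) ha (by omega) hc0
      have h810 : 2 * n - 10 ≤ 2 * n - 8 := by omega
      refine ⟨freyCurve (-(ℓ : ℤ)) (2 ^ n), hE, h₁, hcard.trans ?_, h810.trans hT⟩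
      rw [hc, Int.natAbs_neg, Int.natAbs_natCast, Int.natAbs_natCast, hωℓ]
      omega
    · -- `ℓ ≡ 3 (4)`: `m ≡ 1 (4)`, `a = -m`, `a + 2ⁿ = ℓ`
      have hm1 : m % 4 = 1 := by omega
      have ha : (-(m : ℤ)) ≡ -1 [ZMOD 4] := by
        have : (m : ℤ) % 4 = 1 := by exact_mod_cast hm1
        exact Int.ModEq.neg this
      have hc : -(m : ℤ) + 2 ^ n = ℓ := by
        have := congrArg (fun k : ℕ => (k : ℤ)) hsum; push_cast at this; linarith
      have hc0 : -(m : ℤ) + 2 ^ n ≠ 0 := by rw [hc]; exact_mod_cast hℓ.ne_zero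
      obtain ⟨hE, h₁, hcard, hT⟩ := freyCurve_two_pow_spec (n := n) ha (by omega) hc0
      have h810 : 2 * n - 10 ≤ 2 * n - 8 := by omega
      refine ⟨freyCurve (-(m : ℤ)) (2 ^ n), hE, h₁, hcard.trans ?_, h810.trans hT⟩
      rw [hc, Int.natAbs_neg, Int.natAbs_natCast, Int.natAbs_natCast, hωℓ]
      omega

end TwoPow

end Literature.NumberTheory.EllipticCurves
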